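import Literature.RepresentationTheory.HeisenbergGroup.MetaplecticSumStripping        -- ★ `commutant_schrodingerSB_gram` (+ ★ `SchrodingerDirectSum`: `inlH`, `schrodingerSB_inlH_boxSB`)
import Literature.RepresentationTheory.HeisenbergGroup.SchrodingerSymplecticTransport -- ★ `exists_intertwiner_of_symplectic`
import HarnessLib

/-!
# The fibre of a box: `φ₀ (Ψ (f₁ ⊠ f₂)) = c(f₂) • Ψ₁ f₁` for a slot-respecting symplectic chart

Mœglin–Vignéras–Waldspurger, *Correspondances de Howe sur un corps p-adique*, LNM 1291 (1987), Chap. 2 I.3 (Schur for the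
Schrödinger model), II.1 (A) (transport of the model along a symplectic isomorphism), Chap. 3 §IV.2 (Jacquet modules of Weil
representations computed in mixed models).  THEOREMS ONLY (no `def`, no instance, no notation, no named fact, no `sorry`).

SETTING.  `K` a non-archimedean local field, `ψ` a non-trivial continuous character, `T = T₁ ⊕ T₂` a block Gram matrix on
`K^ι = K^{ι₁} ⊕ K^{ι₂}` (along `e : ι₁ ⊕ ι₂ ≃ ι`) with `det T₁` a unit, and the DOT model on `K^{α ⊕ β}`.  A symplectic chart
`Γ : W_T ≃ K^{α ⊕ β} × K^{α ⊕ β}` is SLOT-RESPECTING when it sends the first summand `W_{T₁}` (vectors glued from `ι₁` and `0`) into the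
`β`-slot (`(Γ w).1 ∘ inl = 0 = (Γ w).2 ∘ inl`).  `Ψ : 𝒮(K^ι) ≃ 𝒮(K^{α ⊕ β})` is an intertwiner of Schrödinger models along the conjugation
coboundary of `Γ` (formula of ★ `exists_intertwiner_of_symplectic`), and `φ₀ : 𝒮(K^{α ⊕ β}) → 𝒮(K^β)` is the fibre map `(φ₀ f)(u) = f(0 ‖ u)`.

RESULTS.
* `fibre_schrodingerSB_sumElim` — (G1) `φ₀` intertwines the `β`-slot Heisenberg operators of the dot model on `K^{α ⊕ β}` with the dot model on `K^β`.
* `exists_eq_smul_of_intertwine` — (G2) SCHUR FOR INTERTWINER FAMILIES: an intertwiner `A : ρ_{T₁} → ρ′` along the same map of Heisenberg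
  groups as an INVERTIBLE intertwiner `Ψ₁` is `c • Ψ₁` (★ `commutant_schrodingerSB_gram` applied to `Ψ₁⁻¹ ∘ A`).
* `exists_lineChart` — (G3) a slot-respecting symplectic `Γ` restricts to a symplectic `Γ₁ : W_{T₁} ≃ K^β × K^β` (`|ι₁| = |β|`) with
  `Γ (w₁ ⊔ 0) = 0 ⊔ Γ₁ w₁`, and the conjugation coboundary of `Γ` on `inlH` is that of `Γ₁`.
* `exists_fibre_boxSB_eq_smul` — (G4) THE FACTORISATION: there are `Γ₁`, an intertwiner `Ψ₁ : 𝒮(K^{ι₁}) ≃ 𝒮(K^β)` along `Γ₁`, and for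
  every `f₂ ∈ 𝒮(K^{ι₂})` a scalar `c` with `φ₀ (Ψ (f₁ ⊠ f₂)) = c • Ψ₁ f₁` for all `f₁` (`⊠ = boxSB K e`).
  Proof: `f₁ ↦ φ₀ (Ψ (f₁ ⊠ f₂))` intertwines `ρ_{T₁}` with the dot model on `K^β` along the coboundary of `Γ₁` (★ `schrodingerSB_inlH_boxSB`,
  the formula of `Ψ`, (G3), (G1)); so does `Ψ₁` (★ `exists_intertwiner_of_symplectic`); (G2).

USE (crux H413, programme P2, N3 (a)-road, brick (BE)): with the CM chart of ★ `F0P2oYCoinvariantsChartCM.exists_chart_of_nonsplit` at a block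
frame, (G4) says the Jacquet-module quotient `π̄ = φ₀ ∘ Ψ` of `r_N(ω_v)` reads a box `f_l ⊠ f_p` as `c(f_p) • Ψ₁ f_l`; with the local see-saw
★ `DoubledBlock.toRep_localSplittingCMWith_inlLoc_boxSB` the torus `d(1, β, 1)` then acts on `r_N(ω_v) ≅ 𝒮(K)` by the rank-one Weil operator.

## References
* [MoeglinVignerasWaldspurger1987] C. Mœglin, M.-F. Vignéras, J.-L. Waldspurger, LNM 1291 (1987): Chap. 2 I.3, II.1 (A); Chap. 3 §IV.2.
* [Kudla1984] S. Kudla, *Seesaw dual reductive pairs*, Progr. Math. 46 (1984): §1.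
-/

set_option autoImplicit false

noncomputable section

open scoped TensorProduct

namespace Literature.RepresentationTheory.HeisenbergGroup

open Literature.NumberTheory.Automorphic
open Literature.NumberTheory.GaloisRepresentations.IsNonarchimedeanLocalField

/-! ## §1 (G3) The line chart of a slot-respecting symplectic chart (linear algebra over any field) -/

section LineChart

variable {K : Type*} [Field K] {ι₁ ι₂ ι α β : Type*} [Fintype ι₁] [Fintype ι₂] [Fintype ι] [Fintype α] [Fintype β]
  [DecidableEq ι₁] [DecidableEq ι₂] [DecidableEq ι] [DecidableEq α] [DecidableEq β]
  (e : ι₁ ⊕ ι₂ ≃ ι) (T₁ : Matrix ι₁ ι₁ K) (T₂ : Matrix ι₂ ι₂ K) {T : Matrix ι ι K}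
  (hT : T = Matrix.reindex e e (Matrix.fromBlocks T₁ 0 0 T₂))
  (Γ : ((ι → K) × (ι → K)) ≃ₗ[K] (((α ⊕ β) → K) × ((α ⊕ β) → K)))
  (hΓ : ∀ w w' : (ι → K) × (ι → K),
    alt (polar (dotProductBilin K K (m := α ⊕ β))) (Γ w) (Γ w') = alt (polar (Matrix.toLinearMap₂' K T)) w w')
  (hsupp : ∀ w₁ : (ι₁ → K) × (ι₁ → K),
    (Γ (glue e w₁.1 0, glue e w₁.2 0)).1 ∘ Sum.inl = (0 : α → K) ∧ (Γ (glue e w₁.1 0, glue e w₁.2 0)).2 ∘ Sum.inl = (0 : α → K))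
  (hcard : Fintype.card ι₁ = Fintype.card β)

omit [Fintype ι₁] [Fintype ι₂] [Fintype ι] [Fintype α] [Fintype β] [DecidableEq ι₁] [DecidableEq ι₂] [DecidableEq ι]
  [DecidableEq α] [DecidableEq β] in
/-- a vector of `K^{α ⊕ β}` vanishing on the `α`-slot is `0 ⊔ (its β-part)`. [folklore] -/
private theorem eq_sumElim_zero_of_comp_inl {g : (α ⊕ β) → K} (hg : g ∘ Sum.inl = (0 : α → K)) : g = Sum.elim (0 : α → K) (g ∘ Sum.inr) := by
  conv_lhs => rw [← Sum.elim_comp_inl_inr g]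
  rw [hg]

include hT in
omit [Fintype α] [Fintype β] [DecidableEq α] [DecidableEq β] in
/-- `β_T(a ⊔ 0, b ⊔ 0) = β_{T₁}(a, b)`. [cite: Kudla1984, §1] -/
private theorem toLinearMap₂'_glue_zero (a b : ι₁ → K) :
    Matrix.toLinearMap₂' K T (glue e a 0) (glue e b 0) = Matrix.toLinearMap₂' K T₁ a b := by
  simp only [toLinearMap₂'_glue e T₁ T₂ hT, map_zero, add_zero]

include hT hΓ hsupp hcard in
omit [DecidableEq α] [DecidableEq β] in
/-- **(G3) THE LINE CHART.**  A symplectic chart `Γ : W_T ≃ K^{α ⊕ β} × K^{α ⊕ β}` (`T = T₁ ⊕ T₂` along `e`) sending the summand `W_{T₁}` into the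
`β`-slot restricts to a symplectic `Γ₁ : W_{T₁} ≃ K^β × K^β` (`|ι₁| = |β|`): `Γ (a ⊔ 0, b ⊔ 0) = (0 ⊔ (Γ₁(a,b)).1, 0 ⊔ (Γ₁(a,b)).2)`,
`alt_{dot,β}(Γ₁ w, Γ₁ w′) = alt_{T₁}(w, w′)`, and the two conjugation coboundaries agree on the summand:
`β_dot(Γ v, Γ v) − β_T(v, v) = β_{dot,β}(Γ₁ w, Γ₁ w) − β_{T₁}(w, w)` for `v = (a ⊔ 0, b ⊔ 0)`, `w = (a, b)`.
[cite: MoeglinVignerasWaldspurger1987, Chap. 2 II.1 (A)] [cite: Kudla1984, §1] -/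
theorem exists_lineChart :
    ∃ Γ₁ : ((ι₁ → K) × (ι₁ → K)) ≃ₗ[K] ((β → K) × (β → K)),
      (∀ w₁ : (ι₁ → K) × (ι₁ → K), Γ (glue e w₁.1 0, glue e w₁.2 0) = (Sum.elim (0 : α → K) (Γ₁ w₁).1, Sum.elim (0 : α → K) (Γ₁ w₁).2)) ∧
      (∀ w₁ w₁' : (ι₁ → K) × (ι₁ → K),
        alt (polar (dotProductBilin K K (m := β))) (Γ₁ w₁) (Γ₁ w₁') = alt (polar (Matrix.toLinearMap₂' K T₁)) w₁ w₁') ∧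
      (∀ w₁ : (ι₁ → K) × (ι₁ → K),
        polar (dotProductBilin K K (m := α ⊕ β)) (Γ (glue e w₁.1 0, glue e w₁.2 0)) (Γ (glue e w₁.1 0, glue e w₁.2 0)) -
            polar (Matrix.toLinearMap₂' K T) (glue e w₁.1 0, glue e w₁.2 0) (glue e w₁.1 0, glue e w₁.2 0) =
          polar (dotProductBilin K K (m := β)) (Γ₁ w₁) (Γ₁ w₁) - polar (Matrix.toLinearMap₂' K T₁) w₁ w₁) := by
  classical
  -- the inclusion of the first summand and the projection to the `β`-slot, as linear maps
  obtain ⟨j₁, hj₁⟩ : ∃ j₁ : ((ι₁ → K) × (ι₁ → K)) →ₗ[K] ((ι → K) × (ι → K)),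
      ∀ w₁, j₁ w₁ = (glue e w₁.1 0, glue e w₁.2 0) :=
    ⟨(splitW e).symm.toLinearMap ∘ₗ LinearMap.inl K _ (((ι₂ → K) × (ι₂ → K))), fun w₁ => by
      simp only [LinearMap.comp_apply, LinearMap.inl_apply, LinearEquiv.coe_coe, splitW_symm_apply, Prod.fst_zero,
        Prod.snd_zero]⟩
  obtain ⟨p₂, hp₂⟩ : ∃ p₂ : (((α ⊕ β) → K) × ((α ⊕ β) → K)) →ₗ[K] ((β → K) × (β → K)),
      ∀ v, p₂ v = (v.1 ∘ Sum.inr, v.2 ∘ Sum.inr) :=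
    ⟨(LinearMap.funLeft K K Sum.inr).prodMap (LinearMap.funLeft K K Sum.inr), fun v => rfl⟩
  -- the candidate `L = p₂ ∘ Γ ∘ j₁` and its support identity
  have hL : ∀ w₁, Γ (glue e w₁.1 0, glue e w₁.2 0) =
      (Sum.elim (0 : α → K) ((p₂ ∘ₗ Γ.toLinearMap ∘ₗ j₁) w₁).1, Sum.elim (0 : α → K) ((p₂ ∘ₗ Γ.toLinearMap ∘ₗ j₁) w₁).2) := fun w₁ => by
    rw [LinearMap.comp_apply, LinearMap.comp_apply, hj₁, LinearEquiv.coe_coe, hp₂]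
    exact Prod.ext (eq_sumElim_zero_of_comp_inl (hsupp w₁).1) (eq_sumElim_zero_of_comp_inl (hsupp w₁).2)
  -- `L` is injective
  have hinj : Function.Injective (p₂ ∘ₗ Γ.toLinearMap ∘ₗ j₁) := by
    rw [← LinearMap.ker_eq_bot, LinearMap.ker_eq_bot']
    intro w₁ hw
    have h0 : Γ (glue e w₁.1 0, glue e w₁.2 0) = 0 := by
      rw [hL, hw, Prod.fst_zero, Prod.snd_zero, Sum.elim_zero_zero, Prod.mk_zero_zero]
    have h1 : (glue e w₁.1 0, glue e w₁.2 0) = (splitW e).symm 0 := by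
      rw [← (splitW e).symm.map_zero.symm.trans rfl, ← Γ.map_eq_zero_iff]; exact h0
    have h2 := congrArg (splitW e) h1
    rw [LinearEquiv.apply_symm_apply, splitW_apply] at h2
    simp only [resL_glue, resR_glue, Prod.ext_iff, Prod.fst_zero, Prod.snd_zero] at h2
    exact Prod.ext h2.1.1 h2.1.2
  -- equal dimensions `2|ι₁| = 2|β|`
  have hdim : Module.finrank K ((ι₁ → K) × (ι₁ → K)) = Module.finrank K ((β → K) × (β → K)) := by
    rw [Module.finrank_prod, Module.finrank_prod, Module.finrank_fintype_fun_eq_card, Module.finrank_fintype_fun_eq_card, hcard]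
  -- dot products of `β`-slot vectors
  have hdot : ∀ a b : β → K, Sum.elim (0 : α → K) a ⬝ᵥ Sum.elim (0 : α → K) b = a ⬝ᵥ b := fun a b => by
    rw [sumElim_dotProduct_sumElim, zero_dotProduct, zero_add]
  refine ⟨(p₂ ∘ₗ Γ.toLinearMap ∘ₗ j₁).linearEquivOfInjective hinj hdim, fun w₁ => ?_, fun w₁ w₁' => ?_, fun w₁ => ?_⟩
  · rw [LinearMap.linearEquivOfInjective_apply]; exact hL w₁
  · rw [LinearMap.linearEquivOfInjective_apply, LinearMap.linearEquivOfInjective_apply, alt_apply, alt_apply, polar_apply,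
      polar_apply, polar_apply, polar_apply, ← toLinearMap₂'_glue_zero e T₁ T₂ hT w₁.1 w₁'.2,
      ← toLinearMap₂'_glue_zero e T₁ T₂ hT w₁'.1 w₁.2, dotProductBilin_apply_apply, dotProductBilin_apply_apply, ← hdot, ← hdot]
    have key := hΓ (glue e w₁.1 0, glue e w₁.2 0) (glue e w₁'.1 0, glue e w₁'.2 0)
    rw [alt_apply, alt_apply, polar_apply, polar_apply, polar_apply, polar_apply, hL, hL, dotProductBilin_apply_apply,
      dotProductBilin_apply_apply] at key
    exact key
  · rw [LinearMap.linearEquivOfInjective_apply, polar_apply, polar_apply, polar_apply, polar_apply, hL,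
      toLinearMap₂'_glue_zero e T₁ T₂ hT, dotProductBilin_apply_apply, dotProductBilin_apply_apply, hdot]

end LineChart

/-! ## §2 (G1) The fibre map and (G2) Schur for intertwiner families -/

section Local

variable {K : Type*} [Field K] [ValuativeRel K] [TopologicalSpace K] [IsNonarchimedeanLocalField K]
  {ψ : AddChar K Circle} (hl : IsLocallyConstant (⇑ψ : K → Circle))

/-- **(G1) THE FIBRE MAP INTERTWINES THE `β`-SLOT.**  For `(φ₀ f)(u) = f(0 ‖ u)`:
`φ₀ (ρ_dot((0 ‖ c, 0 ‖ d), t) f) = ρ_{dot,β}((c, d), t) (φ₀ f)` — `(ρ(h) f)(u) = ψ(t + ⟨u, h₂⟩) f(u + h₁)` and `⟨0 ‖ u, 0 ‖ d⟩ = ⟨u, d⟩`.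
[cite: MoeglinVignerasWaldspurger1987, Chap. 3 §IV.2] -/
theorem fibre_schrodingerSB_sumElim {α β : Type*} [Fintype α] [Fintype β] [DecidableEq α] [DecidableEq β]
    (hbαβ : ∀ y : (α ⊕ β) → K, Continuous fun u : (α ⊕ β) → K => dotProductBilin K K u y)
    (hbβ : ∀ y : β → K, Continuous fun u : β → K => dotProductBilin K K u y)
    (φ₀ : SchwartzBruhat ((α ⊕ β) → K) →ₗ[ℂ] SchwartzBruhat (β → K))
    (hφ₀ : ∀ (f : SchwartzBruhat ((α ⊕ β) → K)) (u : β → K),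
      (φ₀ f : (β → K) → ℂ) u = (f : ((α ⊕ β) → K) → ℂ) (Sum.elim 0 u))
    (h : Heisenberg (polar (dotProductBilin K K (m := β)))) (f : SchwartzBruhat ((α ⊕ β) → K)) :
    φ₀ (schrodingerSB (dotProductBilin K K (m := α ⊕ β)) ψ hl hbαβ ⟨(Sum.elim 0 h.v.1, Sum.elim 0 h.v.2), h.t⟩ f) =
      schrodingerSB (dotProductBilin K K (m := β)) ψ hl hbβ h (φ₀ f) := by
  apply Subtype.ext
  funext u
  rw [hφ₀, schrodingerSB_apply, schrodingerSB_apply, hφ₀]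
  dsimp only
  rw [dotProductBilin_apply_apply, dotProductBilin_apply_apply, sumElim_dotProduct_sumElim, zero_dotProduct, zero_add,
    ← Sum.elim_add_add, add_zero]

/-- **(G2) SCHUR FOR INTERTWINER FAMILIES.**  Let `Ψ₁ : 𝒮(K^{ι₁}) ≃ V′` be an INVERTIBLE intertwiner of `ρ_{T₁}` (`det T₁` a unit) with operators
`ρ′(Φ₁ h)` on `V′` along a map `Φ₁` of `H(W_{T₁})`, and `A : 𝒮(K^{ι₁}) → V′` a linear map intertwining along the same `Φ₁`.  Then `A = c • Ψ₁`:
`Ψ₁⁻¹ ∘ A` commutes with `ρ_{T₁}`, hence is a scalar by ★ `commutant_schrodingerSB_gram`. [cite: MoeglinVignerasWaldspurger1987, Chap. 2 I.3] -/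
theorem exists_eq_smul_of_intertwine {ι₁ : Type*} [Fintype ι₁] [DecidableEq ι₁] (T₁ : Matrix ι₁ ι₁ K) (hT₁ : IsUnit T₁.det)
    (hb₁ : ∀ y : ι₁ → K, Continuous fun u : ι₁ → K => Matrix.toLinearMap₂' K T₁ u y) (hψ : ψ.IsContinuousNontrivial)
    {V' : Type*} [AddCommGroup V'] [Module ℂ V'] {X : Type*} (ρ' : X → V' →ₗ[ℂ] V')
    (Φ₁ : Heisenberg (polar (Matrix.toLinearMap₂' K T₁)) → X)
    (Ψ₁ : SchwartzBruhat (ι₁ → K) ≃ₗ[ℂ] V')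
    (hΨ₁ : ∀ (h : Heisenberg (polar (Matrix.toLinearMap₂' K T₁))) (f : SchwartzBruhat (ι₁ → K)),
      Ψ₁ (schrodingerSB (Matrix.toLinearMap₂' K T₁) ψ hl hb₁ h f) = ρ' (Φ₁ h) (Ψ₁ f))
    (A : SchwartzBruhat (ι₁ → K) →ₗ[ℂ] V')
    (hA : ∀ (h : Heisenberg (polar (Matrix.toLinearMap₂' K T₁))) (f : SchwartzBruhat (ι₁ → K)),
      A (schrodingerSB (Matrix.toLinearMap₂' K T₁) ψ hl hb₁ h f) = ρ' (Φ₁ h) (A f)) :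
    ∃ c : ℂ, ∀ f : SchwartzBruhat (ι₁ → K), A f = c • Ψ₁ f := by
  obtain ⟨c, hc⟩ := commutant_schrodingerSB_gram T₁ hT₁ hl hb₁ hψ (Ψ₁.symm.toLinearMap ∘ₗ A) fun h f => by
    rw [LinearMap.comp_apply, LinearMap.comp_apply, LinearEquiv.coe_coe, hA, LinearEquiv.symm_apply_eq, hΨ₁,
      LinearEquiv.apply_symm_apply]
  refine ⟨c, fun f => ?_⟩
  have h1 := hc f
  rw [LinearMap.comp_apply, LinearEquiv.coe_coe, LinearEquiv.symm_apply_eq, LinearEquiv.map_smul] at h1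
  exact h1

/-! ## §3 (G4) The factorisation of the fibre of a box -/

variable [Invertible (2 : K)] {ι₁ ι₂ ι α β : Type*} [Fintype ι₁] [Fintype ι₂] [Fintype ι] [Fintype α] [Fintype β]
  [DecidableEq ι₁] [DecidableEq ι₂] [DecidableEq ι] [DecidableEq α] [DecidableEq β]
  (e : ι₁ ⊕ ι₂ ≃ ι) (T₁ : Matrix ι₁ ι₁ K) (T₂ : Matrix ι₂ ι₂ K) {T : Matrix ι ι K}
  (hT : T = Matrix.reindex e e (Matrix.fromBlocks T₁ 0 0 T₂)) (hT₁ : IsUnit T₁.det)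
  (hb₁ : ∀ y : ι₁ → K, Continuous fun u : ι₁ → K => Matrix.toLinearMap₂' K T₁ u y)
  (hb : ∀ y : ι → K, Continuous fun u : ι → K => Matrix.toLinearMap₂' K T u y)
  (hbαβ : ∀ y : (α ⊕ β) → K, Continuous fun u : (α ⊕ β) → K => dotProductBilin K K u y)
  (hbβ : ∀ y : β → K, Continuous fun u : β → K => dotProductBilin K K u y)
  (Γ : ((ι → K) × (ι → K)) ≃ₗ[K] (((α ⊕ β) → K) × ((α ⊕ β) → K)))
  (hΓ : ∀ w w' : (ι → K) × (ι → K),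
    alt (polar (dotProductBilin K K (m := α ⊕ β))) (Γ w) (Γ w') = alt (polar (Matrix.toLinearMap₂' K T)) w w')
  (hsupp : ∀ w₁ : (ι₁ → K) × (ι₁ → K),
    (Γ (glue e w₁.1 0, glue e w₁.2 0)).1 ∘ Sum.inl = (0 : α → K) ∧ (Γ (glue e w₁.1 0, glue e w₁.2 0)).2 ∘ Sum.inl = (0 : α → K))
  (hcard : Fintype.card ι₁ = Fintype.card β)
  (Ψ : SchwartzBruhat (ι → K) ≃ₗ[ℂ] SchwartzBruhat ((α ⊕ β) → K))
  (hΨ : ∀ (w : (ι → K) × (ι → K)) (t : K) (f : SchwartzBruhat (ι → K)),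
    Ψ (schrodingerSB (Matrix.toLinearMap₂' K T) ψ hl hb ⟨w, t⟩ f) =
      schrodingerSB (dotProductBilin K K (m := α ⊕ β)) ψ hl hbαβ
        ⟨Γ w, t + ⅟(2 : K) * (polar (dotProductBilin K K (m := α ⊕ β)) (Γ w) (Γ w) - polar (Matrix.toLinearMap₂' K T) w w)⟩ (Ψ f))
  (φ₀ : SchwartzBruhat ((α ⊕ β) → K) →ₗ[ℂ] SchwartzBruhat (β → K))
  (hφ₀ : ∀ (f : SchwartzBruhat ((α ⊕ β) → K)) (u : β → K),
    (φ₀ f : (β → K) → ℂ) u = (f : ((α ⊕ β) → K) → ℂ) (Sum.elim 0 u))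

include hT hT₁ hΓ hsupp hcard hΨ hφ₀ in
/-- **(G4) THE FIBRE OF A BOX FACTORISES.**  In the SETTING of the module docstring: there are the line chart `Γ₁ : W_{T₁} ≃ K^β × K^β` of (G3)
(`Γ (a ⊔ 0, b ⊔ 0) = (0 ⊔ (Γ₁ w).1, 0 ⊔ (Γ₁ w).2)`, symplectic), an intertwiner `Ψ₁ : 𝒮(K^{ι₁}) ≃ 𝒮(K^β)` of `ρ_{T₁}` with the dot model on `K^β` along
the conjugation coboundary of `Γ₁`, and for every `f₂ ∈ 𝒮(K^{ι₂})` a scalar `c` with `φ₀ (Ψ (f₁ ⊠ f₂)) = c • Ψ₁ f₁` for all `f₁ ∈ 𝒮(K^{ι₁})`.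
Proof: `A_{f₂} : f₁ ↦ φ₀ (Ψ (f₁ ⊠ f₂))` intertwines along the coboundary of `Γ₁` — `ρ_T(inlH h)(f₁ ⊠ f₂) = ρ_{T₁}(h) f₁ ⊠ f₂`
(★ `schrodingerSB_inlH_boxSB`), the formula of `Ψ`, (G3), (G1) — and so does `Ψ₁` (★ `exists_intertwiner_of_symplectic`); Schur (G2).
[cite: MoeglinVignerasWaldspurger1987, Chap. 2 I.3, II.1 (A); Chap. 3 §IV.2] [cite: Kudla1984, §1] -/
theorem exists_fibre_boxSB_eq_smul (hψ : ψ.IsContinuousNontrivial) :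
    ∃ (Γ₁ : ((ι₁ → K) × (ι₁ → K)) ≃ₗ[K] ((β → K) × (β → K)))
      (Ψ₁ : SchwartzBruhat (ι₁ → K) ≃ₗ[ℂ] SchwartzBruhat (β → K)),
      (∀ w₁ : (ι₁ → K) × (ι₁ → K), Γ (glue e w₁.1 0, glue e w₁.2 0) = (Sum.elim (0 : α → K) (Γ₁ w₁).1, Sum.elim (0 : α → K) (Γ₁ w₁).2)) ∧
      (∀ w₁ w₁' : (ι₁ → K) × (ι₁ → K),
        alt (polar (dotProductBilin K K (m := β))) (Γ₁ w₁) (Γ₁ w₁') = alt (polar (Matrix.toLinearMap₂' K T₁)) w₁ w₁') ∧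
      (∀ (w₁ : (ι₁ → K) × (ι₁ → K)) (t : K) (f₁ : SchwartzBruhat (ι₁ → K)),
        Ψ₁ (schrodingerSB (Matrix.toLinearMap₂' K T₁) ψ hl hb₁ ⟨w₁, t⟩ f₁) =
          schrodingerSB (dotProductBilin K K (m := β)) ψ hl hbβ
            ⟨Γ₁ w₁, t + ⅟(2 : K) * (polar (dotProductBilin K K (m := β)) (Γ₁ w₁) (Γ₁ w₁) - polar (Matrix.toLinearMap₂' K T₁) w₁ w₁)⟩ (Ψ₁ f₁)) ∧
      ∀ f₂ : SchwartzBruhat (ι₂ → K), ∃ c : ℂ, ∀ f₁ : SchwartzBruhat (ι₁ → K), φ₀ (Ψ (boxSB K e f₁ f₂)) = c • Ψ₁ f₁ := by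
  classical
  obtain ⟨Γ₁, hΓ₁s, hΓ₁a, hΓ₁c⟩ := exists_lineChart e T₁ T₂ hT Γ hΓ hsupp hcard
  -- the intertwiner of the line chart
  obtain ⟨Ψ₁, hΨ₁⟩ := exists_intertwiner_of_symplectic T₁ hT₁ hl hb₁ hbβ Γ₁ hΓ₁a hψ
    (fun h => ⟨Γ₁ h.v, h.t + ⅟(2 : K) * (polar (dotProductBilin K K (m := β)) (Γ₁ h.v) (Γ₁ h.v) - polar (Matrix.toLinearMap₂' K T₁) h.v h.v)⟩)
    (fun _ _ => rfl)
  refine ⟨Γ₁, Ψ₁, hΓ₁s, hΓ₁a, fun w₁ t f₁ => hΨ₁ ⟨w₁, t⟩ f₁, fun f₂ => ?_⟩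
  -- the family `A_{f₂}`
  obtain ⟨A, hAdef⟩ : ∃ A : SchwartzBruhat (ι₁ → K) →ₗ[ℂ] SchwartzBruhat (β → K), ∀ f₁, A f₁ = φ₀ (Ψ (boxSB K e f₁ f₂)) :=
    ⟨{ toFun := fun f₁ => φ₀ (Ψ (boxSB K e f₁ f₂))
       map_add' := fun f₁ f₁' => by rw [boxSB_add_left, map_add, map_add]
       map_smul' := fun c f₁ => by rw [boxSB_smul_left, map_smul, map_smul, RingHom.id_apply] }, fun _ => rfl⟩
  obtain ⟨c, hc⟩ := exists_eq_smul_of_intertwine hl T₁ hT₁ hb₁ hψ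
    (fun h => (schrodingerSB (dotProductBilin K K (m := β)) ψ hl hbβ h : SchwartzBruhat (β → K) →ₗ[ℂ] SchwartzBruhat (β → K)))
    (fun h => ⟨Γ₁ h.v, h.t + ⅟(2 : K) * (polar (dotProductBilin K K (m := β)) (Γ₁ h.v) (Γ₁ h.v) - polar (Matrix.toLinearMap₂' K T₁) h.v h.v)⟩)
    Ψ₁ hΨ₁ A fun h f₁ => by
      -- the formula of `Ψ` on an arbitrary element (structure eta)
      have hΨ' : ∀ (hh : Heisenberg (polar (Matrix.toLinearMap₂' K T))) (f : SchwartzBruhat (ι → K)),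
          Ψ (schrodingerSB (Matrix.toLinearMap₂' K T) ψ hl hb hh f) =
            schrodingerSB (dotProductBilin K K (m := α ⊕ β)) ψ hl hbαβ
              ⟨Γ hh.v, hh.t + ⅟(2 : K) * (polar (dotProductBilin K K (m := α ⊕ β)) (Γ hh.v) (Γ hh.v) -
                polar (Matrix.toLinearMap₂' K T) hh.v hh.v)⟩ (Ψ f) := fun hh f => hΨ hh.v hh.t f
      have key := fibre_schrodingerSB_sumElim hl hbαβ hbβ φ₀ hφ₀
        ⟨Γ₁ h.v, h.t + ⅟(2 : K) * (polar (dotProductBilin K K (m := β)) (Γ₁ h.v) (Γ₁ h.v) - polar (Matrix.toLinearMap₂' K T₁) h.v h.v)⟩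
        (Ψ (boxSB K e f₁ f₂))
      rw [hAdef, hAdef, ← schrodingerSB_inlH_boxSB e T₁ T₂ hT hl hb₁ hb h f₁ f₂, hΨ', inlH_t, inlH_v, hΓ₁c, hΓ₁s]
      exact key
  exact ⟨c, fun f₁ => by rw [← hAdef, hc]⟩

end Local

end Literature.RepresentationTheory.HeisenbergGroup

end
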